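import Mathlib
import HarnessLib
import Summits.Ventures.LatticeQCDFlow.Scoring.IMHAcceptanceRecordJumpKernel
import Summits.Ventures.LatticeQCDFlow.Scoring.SplitChainDependsOn

/-!
# The IMH acceptance record IX: the accepted stream is the jump chain at EVERY lag —
# the law of the `ℓ`-th next acceptance, from any start

HONEST FRAMING: exact (Metropolis-corrected) sampling algorithms for lattice gauge theory; figures
of merit are autocorrelation/cost numbers at stated couplings and volumes; no continuum-physics
claim.  This file is value-free (no number of ours appears) and nothing in it is cited as a fact.

NEW WORK (tree-internal).  VII (`IMHAcceptanceRecordJumpKernel`) made the next-accepted-state law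
of the flow-MCMC record chain `Z_t = (X_t, A_t)` (kernel `imhRecord q w`, I) a Markov kernel
`J̃ = imhJump q w` (`kop J̃ h = J h / α`, `(J h)(x) = ∫ a(x, y) h(y) q(dy)`, `α = imhAcceptMass`)
and proved its ONE-step path meaning; its NOT-CLAIMED list named the `k`-step path law.  It is
proved here, for EVERY weight `w > 0`, EVERY initial record law `μ̂₀` (path law
`JumpPath.recordPath q w μ̂₀`) and EVERY lag, conditionally on ANY past:
* the `ℓ`-th-acceptance operators `JumpPath.Q q w ℓ n` ("the `ℓ`-th acceptance is move `n`, then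
  evaluate `g`"; `Q (ℓ+1) (n+1) = (1 − α) Q (ℓ+1) n + J (Q ℓ n)`): positive, partial sums in `n`
  bounded by `‖g‖_∞` (`abs_sum_range_Q_le`: the `ℓ`-th acceptance happens at most once), and
  `Σ_n Q ℓ n g = (kop J̃)^[ℓ] g` (`hasSum_Q`: summing out WHEN leaves the jump chain);
* THE TOWER OF THE `ℓ`-TH ACCEPTANCE (`kthAccept_tower`; `1{r acceptances among the moves
  a+1..a+n} = JumpPath.ind a n r`; any bounded measurable functional `G` of `Z_{≤a}`, every `n`):
  `E[G · 1{ℓ−1 acceptances among moves a+1..a+n} · A_{a+1+n} g(X_{a+1+n})] = E[G (Q ℓ (n+1) g)(X_a)]`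
  — the exact finite-time law of WHEN and WHERE the `ℓ`-th next acceptance happens;
* summed over `n` (`hasSum_kthAccept`): `Σ_n E[G · 1{m acceptances in between} · A_{a+1+n}
  g(X_{a+1+n})] = E[G · ((kop J̃)^[m+1] g)(X_a)]` — given ANY past, the `(m+1)`-th next accepted
  state is `J̃^{m+1}(X_a, ·)`-distributed: THE ACCEPTED STREAM IS A `J̃`-MARKOV CHAIN FROM ANY
  START, in the sense of all these conditional laws (VII had `m = 0` under stationarity).

Printed counterparts, NAMED ONLY (not used, not cited as facts): the jump chain of a Metropolis
chain is Markov [corpus:paper:arxiv-1910.13316 p.4, §3]; jump-chain representation of MH output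
[corpus:paper:arxiv-1609.02541 p.3, p.12 §6]; Douc–Robert 2011, Lemma 1
[galaxy:pdf:-7173847574603489160 p.2].
NOT CLAIMED: the probability form and total mass one of these laws, and the every-start geometric
thermalisation of the accepted stream at rate `1 − ā` (routine from `hasSum_kthAccept`, VII's
`imhJump_doeblin` and `Exactness.doeblin_nHit_sub_le`; deferred); the stationary pair law `m + 1`
acceptances apart; signed `g` in `hasSum_kthAccept`; the joint law with the sojourn lengths; a
strong-Markov formulation; CLT / variance of accepted-stream estimators; the lattice corollary
(verbatim as in VII, `ā ≥ e^{−2δ}`); continuum statements.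
-/

noncomputable section

namespace Summit.Ventures.LatticeQCDFlow.Scoring

open MeasureTheory ProbabilityTheory Filter Finset Preorder Summit.Ventures.LatticeQCDFlow.Exactness
open scoped ENNReal Topology

variable {Ω : Type*} [MeasurableSpace Ω]

namespace JumpPath

/-- **The `ℓ`-th-acceptance operators** `(Q ℓ n g)(x) = E_x[1{ℓ-th acceptance is move n} g(X_n)]`
(`kthAccept_tower`), by the first-move recursion; `Q 0 n = δ_{n0} · id`. -/
def Q (q : Measure Ω) (w : Ω → ℝ) : ℕ → ℕ → (Ω → ℝ) → Ω → ℝ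
  | 0, 0, g => g
  | 0, _ + 1, _ => fun _ => 0
  | _ + 1, 0, _ => fun _ => 0
  | ℓ + 1, n + 1, g => fun x =>
      (1 - (imhAcceptMass q w x).toReal) * Q q w (ℓ + 1) n g x
        + ∫ y, imhAccept w x y * Q q w ℓ n g y ∂q

omit [MeasurableSpace Ω] in
/-- `1{r acceptances among the moves a+1, …, a+n}` (real-valued count). -/
def ind (a n : ℕ) (r : ℝ) (x : ℕ → Ω × Bool) : ℝ :=
  if ∑ j ∈ range n, acceptFlag (x (a + 1 + j)) = r then 1 else 0

variable {q : Measure Ω} [IsProbabilityMeasure q] {w : Ω → ℝ}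

omit [IsProbabilityMeasure q] in
/-- The first-move recursion of `Q (ℓ+1) (n+1)` (reject: stay at level `ℓ+1`; accept: drop to `ℓ`). -/
theorem Q_succ_succ (ℓ n : ℕ) (g : Ω → ℝ) :
    Q q w (ℓ + 1) (n + 1) g = fun x => (1 - (imhAcceptMass q w x).toReal) * Q q w (ℓ + 1) n g x
      + ∫ y, imhAccept w x y * Q q w ℓ n g y ∂q := rfl

/-- The sharp sup-norm bound of the accept part: `|J v|(x) ≤ α(x) C` for `|v| ≤ C`. -/
theorem abs_integral_imhAccept_mul_le_mass (hw : Measurable w) (hw0 : ∀ x, 0 < w x) {v : Ω → ℝ}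
    {C : ℝ} (hC : ∀ y, |v y| ≤ C) (x : Ω) :
    |∫ y, imhAccept w x y * v y ∂q| ≤ (imhAcceptMass q w x).toReal * C := by
  have ha0 := imhAccept_nonneg hw0 x
  rw [toReal_imhAcceptMass hw hw0, ← integral_mul_const, ← Real.norm_eq_abs]
  exact norm_integral_le_of_norm_le ((integrable_of_bounded q (measurable_imhAccept_right hw x)
    (C := 1) fun y => by rw [abs_of_nonneg (ha0 y)]; exact imhAccept_le_one w x y).mul_const C)
    (ae_of_all _ fun y => by
      rw [Real.norm_eq_abs, abs_mul, abs_of_nonneg (ha0 y)]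
      exact mul_le_mul_of_nonneg_left (hC y) (ha0 y))

/-- `|(1 − α) u + v| ≤ C` for `|u| ≤ C`, `|v| ≤ α C`: the recursion does not expand sup norms. -/
theorem abs_rejectComb_le (x : Ω) {u v C : ℝ} (hu : |u| ≤ C)
    (hv : |v| ≤ (imhAcceptMass q w x).toReal * C) :
    |(1 - (imhAcceptMass q w x).toReal) * u + v| ≤ C := by
  have h1 : 0 ≤ 1 - (imhAcceptMass q w x).toReal := sub_nonneg.2 (toReal_imhAcceptMass_le_one x)
  calc _ ≤ |(1 - (imhAcceptMass q w x).toReal) * u| + |v| := abs_add_le _ _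
    _ ≤ (1 - (imhAcceptMass q w x).toReal) * C + (imhAcceptMass q w x).toReal * C := by
        rw [abs_mul, abs_of_nonneg h1]; exact add_le_add (mul_le_mul_of_nonneg_left hu h1) hv
    _ = C := by ring

/-- `Q ℓ n g` is measurable and `|Q ℓ n g| ≤ ‖g‖_∞`. -/
theorem measurable_Q_abs_le (hw : Measurable w) (hw0 : ∀ x, 0 < w x) {g : Ω → ℝ}
    (hg : Measurable g) {C : ℝ} (hC : ∀ x, |g x| ≤ C) :
    ∀ n ℓ : ℕ, Measurable (Q q w ℓ n g) ∧ ∀ x, |Q q w ℓ n g x| ≤ C := by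
  have h0 : Measurable (fun _ : Ω => (0 : ℝ)) ∧ ∀ x : Ω, |(fun _ : Ω => (0 : ℝ)) x| ≤ C :=
    ⟨measurable_const, fun x => by rw [abs_zero]; exact (abs_nonneg _).trans (hC x)⟩
  intro n
  induction n with
  | zero => rintro (_ | ℓ); exacts [⟨hg, hC⟩, h0]
  | succ n ih =>
    rintro (_ | ℓ)
    · exact h0
    · obtain ⟨hm1, hb1⟩ := ih (ℓ + 1)
      obtain ⟨hm0, hb0⟩ := ih ℓ
      exact ⟨((measurable_const.sub (measurable_toReal_imhAcceptMass hw)).mul hm1).add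
          (measurable_integral_imhAccept_mul hw hw0 hm0 hb0),
        fun x => abs_rejectComb_le x (hb1 x) (abs_integral_imhAccept_mul_le_mass hw hw0 hb0 x)⟩

/-- `Q ℓ n` is positive. -/
theorem Q_apply_nonneg (hw0 : ∀ x, 0 < w x) {g : Ω → ℝ} (hg0 : ∀ x, 0 ≤ g x) :
    ∀ n ℓ x, 0 ≤ Q q w ℓ n g x := by
  intro n
  induction n with
  | zero => rintro (_ | ℓ) x; exacts [hg0 x, le_rfl]
  | succ n ih =>
    rintro (_ | ℓ) x
    · exact le_rfl
    · exact add_nonneg (mul_nonneg (sub_nonneg.2 (toReal_imhAcceptMass_le_one x)) (ih _ x))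
        (integral_nonneg fun y => mul_nonneg (imhAccept_nonneg hw0 x y) (ih ℓ y))

/-- Partial sums, level `ℓ+1`: `Σ_{n≤N} Q (ℓ+1) n = (1 − α) Σ_{n<N} Q (ℓ+1) n + J Σ_{n<N} Q ℓ n`. -/
theorem sum_range_succ_Q_succ (hw : Measurable w) (hw0 : ∀ x, 0 < w x) {g : Ω → ℝ}
    (hg : Measurable g) {C : ℝ} (hC : ∀ x, |g x| ≤ C) (N ℓ : ℕ) (x : Ω) :
    ∑ n ∈ range (N + 1), Q q w (ℓ + 1) n g x
      = (1 - (imhAcceptMass q w x).toReal) * ∑ n ∈ range N, Q q w (ℓ + 1) n g x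
        + ∫ y, imhAccept w x y * ∑ n ∈ range N, Q q w ℓ n g y ∂q := by
  have hI : ∀ n, Integrable (fun y => imhAccept w x y * Q q w ℓ n g y) q := fun n => by
    obtain ⟨hm, hb⟩ := measurable_Q_abs_le (q := q) hw hw0 hg hC n ℓ
    exact integrable_of_bounded q ((measurable_imhAccept_right hw x).mul hm) (C := 1 * C)
      fun y => by
        rw [abs_mul, abs_of_nonneg (imhAccept_nonneg hw0 x y)]
        exact mul_le_mul (imhAccept_le_one w x y) (hb y) (abs_nonneg _) zero_le_one
  simp only [sum_range_succ', Q, add_zero]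
  rw [sum_add_distrib, ← mul_sum, ← integral_finsetSum _ fun n _ => hI n]
  congr 1
  exact integral_congr_ae (ae_of_all _ fun y => (mul_sum _ _ _).symm)

/-- **The partial sums never exceed `‖g‖_∞`** (the `ℓ`-th acceptance happens at most once). -/
theorem abs_sum_range_Q_le (hw : Measurable w) (hw0 : ∀ x, 0 < w x) {g : Ω → ℝ}
    (hg : Measurable g) {C : ℝ} (hC : ∀ x, |g x| ≤ C) :
    ∀ N ℓ x, |∑ n ∈ range N, Q q w ℓ n g x| ≤ C := by
  intro N
  induction N with
  | zero => intro ℓ x; rw [sum_range_zero, abs_zero]; exact (abs_nonneg _).trans (hC x)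
  | succ N ih =>
    rintro (_ | ℓ) x
    · simp only [sum_range_succ', Q, sum_const_zero, zero_add]; exact hC x
    · rw [sum_range_succ_Q_succ hw hw0 hg hC]
      exact abs_rejectComb_le x (ih _ x) (abs_integral_imhAccept_mul_le_mass hw hw0 (fun y => ih ℓ y) x)

/-- **THE SUM OVER THE MOVE NUMBER IS THE JUMP CHAIN**: `Σ_n Q ℓ n g = (kop J̃)^[ℓ] g` pointwise,
for bounded measurable `g ≥ 0`. -/
theorem hasSum_Q (hw : Measurable w) (hw0 : ∀ x, 0 < w x) {g : Ω → ℝ} (hg : Measurable g)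
    (hg0 : ∀ x, 0 ≤ g x) {C : ℝ} (hC : ∀ x, |g x| ≤ C) (ℓ : ℕ) (x : Ω) :
    HasSum (fun n => Q q w ℓ n g x) ((kop (imhJump q w))^[ℓ] g x) := by
  have hsum : ∀ ℓ x, Summable fun n => Q q w ℓ n g x := fun ℓ x =>
    summable_of_sum_range_le (fun n => Q_apply_nonneg hw0 hg0 n ℓ x) fun N =>
      (le_abs_self _).trans (abs_sum_range_Q_le hw hw0 hg hC N ℓ x)
  have hT : ∀ ℓ x, Tendsto (fun N => ∑ n ∈ range N, Q q w ℓ n g x) atTop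
      (𝓝 (∑' n, Q q w ℓ n g x)) := fun ℓ x => (hsum ℓ x).hasSum.tendsto_sum_nat
  suffices key : ∀ ℓ x, ∑' n, Q q w ℓ n g x = (kop (imhJump q w))^[ℓ] g x by
    rw [← key ℓ x]; exact (hsum ℓ x).hasSum
  intro ℓ
  induction ℓ with
  | zero =>
    intro x
    rw [Function.iterate_zero_apply]
    exact tendsto_nhds_unique ((hT 0 x).comp (tendsto_add_atTop_nat 1))
      (tendsto_const_nhds.congr fun N => by simp [sum_range_succ', Q])
  | succ ℓ ih =>
    intro x
    have hJ : Tendsto (fun N => ∫ y, imhAccept w x y * ∑ n ∈ range N, Q q w ℓ n g y ∂q) atTop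
        (𝓝 (∫ y, imhAccept w x y * (kop (imhJump q w))^[ℓ] g y ∂q)) := by
      refine tendsto_integral_of_dominated_convergence (fun _ => C)
        (fun N => ((measurable_imhAccept_right hw x).mul (Finset.measurable_sum _ fun n _ =>
          (measurable_Q_abs_le hw hw0 hg hC n ℓ).1)).aestronglyMeasurable)
        (integrable_const C) (fun N => ae_of_all _ fun y => ?_) (ae_of_all _ fun y => ?_)
      · rw [Real.norm_eq_abs, abs_mul, abs_of_nonneg (imhAccept_nonneg hw0 x y)]
        exact (mul_le_of_le_one_left (abs_nonneg _) (imhAccept_le_one w x y)).trans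
          (abs_sum_range_Q_le hw hw0 hg hC N ℓ y)
      · rw [← ih y]; exact (hT ℓ y).const_mul _
    have h2 : Tendsto (fun N => ∑ n ∈ range (N + 1), Q q w (ℓ + 1) n g x) atTop
        (𝓝 ((1 - (imhAcceptMass q w x).toReal) * ∑' n, Q q w (ℓ + 1) n g x
          + ∫ y, imhAccept w x y * (kop (imhJump q w))^[ℓ] g y ∂q)) := by
      simp_rw [sum_range_succ_Q_succ hw hw0 hg hC]
      exact ((hT (ℓ + 1) x).const_mul _).add hJ
    have heq := tendsto_nhds_unique ((hT (ℓ + 1) x).comp (tendsto_add_atTop_nat 1)) h2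
    rw [Function.iterate_succ_apply', kop_imhJump hw hw0 _ x,
      eq_div_iff (toReal_imhAcceptMass_pos hw hw0 x).ne']
    linear_combination heq

/-- `1{r acceptances among moves a+1..a+n} · A_{a+1+n} g(X_{a+1+n})` is measurable, `≤ ‖g‖_∞`. -/
theorem measurable_hit_abs_le {g : Ω → ℝ} (hg : Measurable g) {Cg : ℝ} (hCg : ∀ x, |g x| ≤ Cg)
    (a n : ℕ) (r : ℝ) :
    Measurable (fun x : ℕ → Ω × Bool => ind a n r x * (acceptFlag (x (a + 1 + n)) * g (x (a + 1 + n)).1))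
      ∧ ∀ x : ℕ → Ω × Bool, |ind a n r x * (acceptFlag (x (a + 1 + n)) * g (x (a + 1 + n)).1)| ≤ Cg := by
  refine ⟨(Measurable.ite (measurableSet_eq_fun (Finset.measurable_sum _ fun j _ =>
      measurable_acceptFlag.comp (measurable_pi_apply _)) measurable_const) measurable_const
      measurable_const).mul ((measurable_acceptFlag.comp (measurable_pi_apply _)).mul
      (hg.comp (measurable_fst.comp (measurable_pi_apply _)))), fun x => ?_⟩
  rw [abs_mul, abs_mul]
  calc _ ≤ 1 * (1 * Cg) :=
        mul_le_mul (by unfold ind; split_ifs <;> simp) (mul_le_mul (abs_acceptFlag_le _) (hCg _)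
          (abs_nonneg _) zero_le_one) (mul_nonneg (abs_nonneg _) (abs_nonneg _)) zero_le_one
    _ = Cg := by ring

/-- The law of the record path `(Z_t)_{t ≥ 0}` started from the record law `μ̂₀`
(I's `imhRecordPath q w π` is the case `μ̂₀ = imhRecord q w ∘ₘ π`). -/
abbrev recordPath (q : Measure Ω) [IsProbabilityMeasure q] (w : Ω → ℝ) [Fact (Measurable w)]
    (μ₀ : Measure (Ω × Bool)) : Measure (ℕ → Ω × Bool) :=
  Kernel.trajMeasure (X := fun _ : ℕ => Ω × Bool) μ₀
    (fun t : ℕ => (Kernel.prodMkRight Bool (imhRecord q w)).comap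
      (fun y : (i : ↥(Finset.Iic t)) → Ω × Bool => y ⟨t, Finset.mem_Iic.2 le_rfl⟩)
      (measurable_pi_apply _))

end JumpPath

variable {q : Measure Ω} [IsProbabilityMeasure q] {w : Ω → ℝ}

section Path
variable [Fact (Measurable w)]

/-- **THE TOWER OF THE `ℓ`-TH ACCEPTANCE** (any initial record law `μ̂₀`; bounded measurable `G`
depending only on `Z_{≤a}`, bounded measurable `g`, every `n`, `ℓ`):
`E[G · 1{ℓ−1 acceptances among moves a+1..a+n} · A_{a+1+n} g(X_{a+1+n})] = E[G (Q ℓ (n+1) g)(X_a)]`. -/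
theorem kthAccept_tower (hw0 : ∀ x, 0 < w x) (μ₀ : Measure (Ω × Bool)) [IsProbabilityMeasure μ₀]
    {g : Ω → ℝ} (hg : Measurable g) {Cg : ℝ} (hCg : ∀ x, |g x| ≤ Cg) :
    ∀ (n a ℓ : ℕ) {G : (ℕ → Ω × Bool) → ℝ}, Measurable G → DependsOn G (Set.Iic a) →
      ∀ {CG : ℝ}, (∀ x, |G x| ≤ CG) →
      ∫ x, G x * (JumpPath.ind a n ((ℓ : ℝ) - 1) x * (acceptFlag (x (a + 1 + n)) * g (x (a + 1 + n)).1))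
          ∂(JumpPath.recordPath q w μ₀)
        = ∫ x, G x * JumpPath.Q q w ℓ (n + 1) g (x a).1 ∂(JumpPath.recordPath q w μ₀) := by
  intro n
  have hw : Measurable w := Fact.out
  have hQ := JumpPath.measurable_Q_abs_le (q := q) hw hw0 hg hCg
  have hY := JumpPath.measurable_hit_abs_le (Ω := Ω) hg hCg
  -- the count is `≥ 0`: the level-`0` indicator (`cnt = -1`) vanishes
  have hvan : ∀ (k b : ℕ) (x : ℕ → Ω × Bool), JumpPath.ind b k (((0 : ℕ) : ℝ) - 1) x = 0 :=
    fun k b x => if_neg fun h => by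
      have h0 : (0 : ℝ) ≤ ∑ j ∈ range k, acceptFlag (x (b + 1 + j)) :=
        sum_nonneg fun j _ => by unfold acceptFlag; split_ifs <;> norm_num
      rw [h] at h0; norm_num at h0
  have tower : ∀ (a : ℕ) {G : (ℕ → Ω × Bool) → ℝ}, Measurable G → DependsOn G (Set.Iic a) →
      ∀ {CG : ℝ}, (∀ x, |G x| ≤ CG) → ∀ {φ : Ω × Bool → ℝ} {h r : Ω → ℝ}, Measurable φ →
      (∀ z, |φ z| ≤ 1) → Measurable h → (∀ y, |h y| ≤ Cg) →
      kop (Kernel.prodMkRight Bool (imhRecord q w)) (fun z => φ z * h z.1) = (fun z => r z.1) →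
      ∫ x, G x * φ (x (a + 1)) * h (x (a + 1)).1 ∂(JumpPath.recordPath q w μ₀)
        = ∫ x, G x * r (x a).1 ∂(JumpPath.recordPath q w μ₀) :=
    fun a G hG hGd CG hCG φ h r hφ hφb hh hhb hr => by
      have k := chain_tower_dependsOn (Kernel.prodMkRight Bool (imhRecord q w)) μ₀ a hG hGd hCG
        (g := fun z => φ z * h z.1) (hφ.mul (hh.comp measurable_fst)) (Cg := 1 * Cg) fun z => by
          rw [abs_mul]; exact mul_le_mul (hφb z) (hhb z.1) (abs_nonneg _) zero_le_one
      rw [hr] at k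
      simpa only [mul_assoc] using k
  induction n with
  | zero =>
    intro a ℓ G hG hGd CG hCG
    have key := tower a hG hGd hCG measurable_acceptFlag abs_acceptFlag_le hg hCg
      (r := fun y => ∫ y', imhAccept w y y' * g y' ∂q) (kop_imhRecord_acceptFlag_mul hw hw0 hg hCg)
    rcases ℓ with _ | _ | ℓ
    · simp only [hvan, zero_mul, mul_zero, integral_zero, JumpPath.Q]
    · simpa [JumpPath.Q, JumpPath.ind, mul_assoc] using key
    · have hne : ∀ x : ℕ → Ω × Bool, JumpPath.ind a 0 (((ℓ + 1 + 1 : ℕ) : ℝ) - 1) x = 0 :=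
        fun x => if_neg fun h => by
          rw [sum_range_zero] at h; push_cast at h; linarith [(Nat.cast_nonneg ℓ : (0 : ℝ) ≤ ℓ)]
      simp only [hne, zero_mul, mul_zero, integral_zero, add_zero, JumpPath.Q]
  | succ n ih =>
    intro a ℓ G hG hGd CG hCG
    rcases ℓ with _ | ℓ
    · simp only [hvan, zero_mul, mul_zero, integral_zero, JumpPath.Q]
    -- split on the first move: `cnt(a, n+1) = A_{a+1} + cnt(a+1, n)`
    have hidx : a + 1 + (n + 1) = a + 1 + 1 + n := by omega
    have hsplit : ∀ x : ℕ → Ω × Bool, JumpPath.ind a (n + 1) (((ℓ + 1 : ℕ) : ℝ) - 1) x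
        = (1 - acceptFlag (x (a + 1))) * JumpPath.ind (a + 1) n (((ℓ + 1 : ℕ) : ℝ) - 1) x
          + acceptFlag (x (a + 1)) * JumpPath.ind (a + 1) n ((ℓ : ℝ) - 1) x := by
      intro x
      have hc : ((ℓ + 1 : ℕ) : ℝ) - 1 = (ℓ : ℝ) - 1 + 1 := by push_cast; ring
      unfold JumpPath.ind acceptFlag
      rw [sum_range_succ', hc, add_zero, sum_congr rfl fun j _ =>
        show (if (x (a + 1 + (j + 1))).2 then (1 : ℝ) else 0) = if (x (a + 1 + 1 + j)).2 then 1 else 0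
          by rw [show a + 1 + (j + 1) = a + 1 + 1 + j by omega]]
      by_cases hb : (x (a + 1)).2 = true
      · rw [if_pos hb]; simp only [add_left_inj, sub_self, zero_mul, one_mul, zero_add]
      · rw [if_neg hb]; simp only [add_zero, sub_zero, one_mul, zero_mul]
    have hdep : ∀ φ : Ω × Bool → ℝ,
        DependsOn (fun x : ℕ → Ω × Bool => G x * φ (x (a + 1))) (Set.Iic (a + 1)) :=
      fun φ x y hxy => by
        dsimp only
        rw [hGd fun i hi => hxy i (Set.Iic_subset_Iic.2 (Nat.le_succ a) hi),
          hxy (a + 1) (Set.mem_Iic.2 le_rfl)]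
    have hGφ : ∀ {φ : Ω × Bool → ℝ}, Measurable φ → (∀ z, |φ z| ≤ 1) →
        Measurable (fun x : ℕ → Ω × Bool => G x * φ (x (a + 1))) ∧
          ∀ x : ℕ → Ω × Bool, |G x * φ (x (a + 1))| ≤ CG * 1 := fun hφ hφb =>
      ⟨hG.mul (hφ.comp (measurable_pi_apply _)), fun x => by
        rw [abs_mul]
        exact mul_le_mul (hCG x) (hφb _) (abs_nonneg _) ((abs_nonneg _).trans (hCG x))⟩
    have hmr : Measurable fun z : Ω × Bool => 1 - acceptFlag z :=
      measurable_const.sub measurable_acceptFlag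
    have hR := hGφ hmr abs_one_sub_acceptFlag_le
    have hA := hGφ measurable_acceptFlag abs_acceptFlag_le
    have hInt : ∀ {φ ψ : (ℕ → Ω × Bool) → ℝ}, Measurable φ → Measurable ψ → ∀ {B B' : ℝ},
        (∀ x, |φ x| ≤ B) → (∀ x, |ψ x| ≤ B') →
        Integrable (fun x => φ x * ψ x) (JumpPath.recordPath q w μ₀) :=
      fun hφ hψ B B' hB hB' => integrable_of_bounded _ (hφ.mul hψ) (C := B * B') fun x => by
        rw [abs_mul]; exact mul_le_mul (hB x) (hB' x) (abs_nonneg _) ((abs_nonneg _).trans (hB x))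
    obtain ⟨hQ1m, hQ1b⟩ := hQ (n + 1) (ℓ + 1)
    obtain ⟨hQ0m, hQ0b⟩ := hQ (n + 1) ℓ
    have ihr := ih (a + 1) (ℓ + 1) hR.1 (hdep fun z => 1 - acceptFlag z) hR.2
    have iha := ih (a + 1) ℓ hA.1 (hdep acceptFlag) hA.2
    have keyr := tower a hG hGd hCG hmr abs_one_sub_acceptFlag_le hQ1m hQ1b
      (r := fun y => (1 - (imhAcceptMass q w y).toReal) * JumpPath.Q q w (ℓ + 1) (n + 1) g y)
      (kop_imhRecord_rejectFlag_mul hw hw0 hQ1m hQ1b)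
    have keya := tower a hG hGd hCG measurable_acceptFlag abs_acceptFlag_le hQ0m hQ0b
      (r := fun y => ∫ y', imhAccept w y y' * JumpPath.Q q w ℓ (n + 1) g y' ∂q)
      (kop_imhRecord_acceptFlag_mul hw hw0 hQ0m hQ0b)
    beta_reduce at ihr iha keyr keya
    have hI1 : Integrable (fun x : ℕ → Ω × Bool => G x * ((1 - (imhAcceptMass q w (x a).1).toReal)
        * JumpPath.Q q w (ℓ + 1) (n + 1) g (x a).1)) (JumpPath.recordPath q w μ₀) :=
      hInt (ψ := fun x : ℕ → Ω × Bool => (1 - (imhAcceptMass q w (x a).1).toReal)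
          * JumpPath.Q q w (ℓ + 1) (n + 1) g (x a).1) hG
        (((measurable_const.sub (measurable_toReal_imhAcceptMass hw)).mul hQ1m).comp
          (measurable_fst.comp (measurable_pi_apply a))) hCG (B' := 1 * Cg) fun x => by
        rw [abs_mul, abs_of_nonneg (sub_nonneg.2 (toReal_imhAcceptMass_le_one _))]
        exact mul_le_mul (sub_le_self _ ENNReal.toReal_nonneg) (hQ1b _) (abs_nonneg _) zero_le_one
    have hI2 : Integrable (fun x : ℕ → Ω × Bool => G x
        * ∫ y, imhAccept w (x a).1 y * JumpPath.Q q w ℓ (n + 1) g y ∂q) (JumpPath.recordPath q w μ₀) :=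
      hInt (ψ := fun x : ℕ → Ω × Bool => ∫ y, imhAccept w (x a).1 y * JumpPath.Q q w ℓ (n + 1) g y ∂q)
        hG ((measurable_integral_imhAccept_mul hw hw0 hQ0m hQ0b).comp
          (measurable_fst.comp (measurable_pi_apply a))) hCG
        fun x => abs_integral_imhAccept_mul_le hw hw0 hQ0m hQ0b _
    rw [show ∫ x, G x * JumpPath.Q q w (ℓ + 1) (n + 1 + 1) g (x a).1 ∂(JumpPath.recordPath q w μ₀)
        = ∫ x, G x * ((1 - (imhAcceptMass q w (x a).1).toReal)
            * JumpPath.Q q w (ℓ + 1) (n + 1) g (x a).1) ∂(JumpPath.recordPath q w μ₀)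
          + ∫ x, G x * ∫ y, imhAccept w (x a).1 y * JumpPath.Q q w ℓ (n + 1) g y ∂q
            ∂(JumpPath.recordPath q w μ₀) from by
        rw [← integral_add hI1 hI2]
        exact integral_congr_ae (ae_of_all _ fun x => by rw [JumpPath.Q_succ_succ ℓ (n + 1) g]; ring),
      ← ihr.trans keyr, ← iha.trans keya, ← integral_add (hInt hR.1 (hY (a + 1) n _).1 hR.2
        (hY (a + 1) n _).2) (hInt hA.1 (hY (a + 1) n _).1 hA.2 (hY (a + 1) n _).2)]
    exact integral_congr_ae (ae_of_all _ fun x => by dsimp only; rw [hsplit x, hidx]; ring)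

/-- **… SUMMED OVER THE TIME: THE `(m+1)`-TH NEXT ACCEPTED STATE IS `J̃^{m+1}(X_a, ·)`-DISTRIBUTED,
GIVEN ANY PAST** (any start; `G` as above, bounded measurable `g ≥ 0`):
`Σ_n E[G · 1{m acceptances among a+1..a+n} · A_{a+1+n} g(X_{a+1+n})] = E[G ((kop J̃)^[m+1] g)(X_a)]`. -/
theorem hasSum_kthAccept (hw0 : ∀ x, 0 < w x) (μ₀ : Measure (Ω × Bool)) [IsProbabilityMeasure μ₀]
    {g : Ω → ℝ} (hg : Measurable g) (hg0 : ∀ x, 0 ≤ g x) {Cg : ℝ} (hCg : ∀ x, |g x| ≤ Cg)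
    (a m : ℕ) {G : (ℕ → Ω × Bool) → ℝ} (hG : Measurable G) (hGd : DependsOn G (Set.Iic a))
    {CG : ℝ} (hCG : ∀ x, |G x| ≤ CG) :
    HasSum (fun n => ∫ x, G x * (JumpPath.ind a n m x * (acceptFlag (x (a + 1 + n))
        * g (x (a + 1 + n)).1)) ∂(JumpPath.recordPath q w μ₀))
      (∫ x, G x * (kop (imhJump q w))^[m + 1] g (x a).1 ∂(JumpPath.recordPath q w μ₀)) := by
  have hw : Measurable w := Fact.out
  haveI := isMarkovKernel_imhJump (q := q) hw hw0
  have hQ := fun n => JumpPath.measurable_Q_abs_le (q := q) hw hw0 hg hCg n (m + 1)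
  obtain ⟨hSm, hSb⟩ := iterate_kop_bounded_measurable (imhJump q w) hg hCg (m + 1)
  have hser : ∀ y, HasSum (fun n => JumpPath.Q q w (m + 1) (n + 1) g y)
      ((kop (imhJump q w))^[m + 1] g y) := fun y =>
    (hasSum_nat_add_iff (f := fun i => JumpPath.Q q w (m + 1) i g y) 1).2 (by
      simp only [sum_range_one, JumpPath.Q, add_zero]
      exact JumpPath.hasSum_Q (q := q) hw hw0 hg hg0 hCg (m + 1) y)
  have hterm : ∀ n, ∫ x, G x * (JumpPath.ind a n m x * (acceptFlag (x (a + 1 + n))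
      * g (x (a + 1 + n)).1)) ∂(JumpPath.recordPath q w μ₀)
      = ∫ x, G x * JumpPath.Q q w (m + 1) (n + 1) g (x a).1 ∂(JumpPath.recordPath q w μ₀) :=
    fun n => by
      have h := kthAccept_tower (q := q) hw0 μ₀ hg hCg n a (m + 1) hG hGd hCG
      simp only [Nat.cast_succ, add_sub_cancel_right] at h
      exact h
  rw [funext hterm]
  refine hasSum_integral_of_dominated_convergence
    (F := fun n x => G x * JumpPath.Q q w (m + 1) (n + 1) g (x a).1)
    (f := fun x => G x * (kop (imhJump q w))^[m + 1] g (x a).1)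
    (fun n x => |CG| * JumpPath.Q q w (m + 1) (n + 1) g (x a).1)
    (fun n => (hG.mul ((hQ (n + 1)).1.comp (measurable_fst.comp (measurable_pi_apply a))))
      |>.aestronglyMeasurable)
    (fun n => ae_of_all _ fun x => ?_)
    (ae_of_all _ fun x => (hser (x a).1).summable.mul_left _)
    ((integrable_of_bounded _ (hSm.comp (measurable_fst.comp (measurable_pi_apply a)))
      (fun x => hSb (x a).1) |>.const_mul |CG|).congr (ae_of_all _ fun x =>
      ((hser (x a).1).mul_left |CG|).tsum_eq.symm))
    (ae_of_all _ fun x => (hser (x a).1).mul_left (G x))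
  rw [Real.norm_eq_abs, abs_mul, abs_of_nonneg (JumpPath.Q_apply_nonneg hw0 hg0 _ _ _)]
  exact mul_le_mul_of_nonneg_right (hCG x |>.trans (le_abs_self _)) (JumpPath.Q_apply_nonneg hw0 hg0 _ _ _)

end Path

end Summit.Ventures.LatticeQCDFlow.Scoring
end
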